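import Summits.QuantumFields.BalabanUV.T4Continuum.Support.NE7EtaSmoothGaugeTransport

/-!
# NE7EtaRegularGaugeInvariance — route #1 of the NE7 crux, stub S7 (NODE O, the BACKGROUND COORDINATE): the class data `Regular` of the
# run-B minimiser is GAUGE INVARIANT, so the smooth-gauge selection of NODE O's bill keeps the hypotheses of NE3's root verbatim

Cell `pub-balaban`, rung (B)+1 sub-cell t4, lineage `b2b-balaban-t4-ne7-p1`, generation 24 (CRUX PROVER NE7 #1, ruling e34b3e0c); crux
skeleton `t4/skeletons/NE7-CRUX-R1.md` v1.7.3 §5 (G5) item (3); sequel of `NE7EtaSmoothGaugeTransport` (p256456).  HONEST FRAMING (page 1):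
FIXED FINITE T⁴, rung (B)+1; NE7, NE3 NOT PRINTED in [Balaban1984PropagatorsI]–[Balaban1989LargeFieldII] and NOT PROVED here; continuum YM on
T⁴ ⇐ BetaPertH ∧ nine spine estimates (0/9 proved); BetaPertH ⇐ (D1) ∧ (D4) ∧ CAP+tail; G-an2-4 gates asym, D1 and NE2/3/4; NOT infinite volume,
NOT mass gap, NOT Clay.

WHY.  NE3's root (amendment 4) is hypothesised on minimiser pairs with `Regular d L N b g (k+1) U_B` (unitary, periodic, small field of radius
`b·ξ²`, and the flux-gradient budget `‖∇_U F‖²_{ℓ²(period)} ≤ g N^d η^{6−d}`).  NODE O's carrier re-gauges run B into a smooth gauge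
(`NE7EtaSmoothGaugeTransport.isMinimiser_pair_gaugeAct` moves the PAIR to the datum `ū·V`); to apply the root to the re-gauged pair one needs
`Regular … (U_B^{u_B})`.  This file proves it: every field of `Regular` is invariant under unitary periodic site gauges — the flux-gradient budget
because the K-datum summand `‖(∇_U F)(x, κ; π)‖` is (tree `AveragingDeficitKDatum.norm_covGrad_flux_eq_of_gaugeAct`, on small fields of radius `< 1`).
 * `gradFluxSq_gaugeAct` — `gradFluxSq (U^u) S = gradFluxSq U S` for unitary `u` and `SmallField U a`, `a < 1`;
 * **`regular_gaugeAct`** — `Regular d L N b g j U`, `b < 1`, `1 ≤ L`, `u` unitary and `N·L^j`-periodic ⟹ `Regular d L N b g j (U^u)`;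
 * **`covRoot_hypotheses_gaugeAct`** — the triple (run-A minimiser, run-B minimiser, `Regular` run-B) for the datum `V` at levels `j+1, j+2` is
   carried to the same triple for the re-gauged pair at the datum `ū·V` (`isMinimiser_pair_gaugeAct` + `regular_gaugeAct`): the root's three
   antecedents hold VERBATIM for the selection of the bill (G5) item (3).
HONEST.  [folklore] bookkeeping over landed modules; nothing of NE3∕NE7 discharged; no carrier instantiated; 0 def; 0 sorry; nothing printed is a
hypothesis of a theorem.
-/

set_option autoImplicit false

open scoped BigOperators Matrix Matrix.Norms.L2Operator
open Finset NormedSpace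

namespace Summit.QuantumFields.BalabanUV.T4Continuum.NE7EtaRegularGaugeInvariance

open Literature.MathematicalPhysics.QuantumFieldTheory.Balaban1983to89
open B7Prop1Explicit B7Prop2Explicit
open T4AveragingDeficitWall hiding Site Plane Plaq Bond
open T4AveragingDeficitWallBoundary (periodBox IsPeriodicCfg)
open AveragingDeficitMultiLevelPrep (LevelSmall)
open AveragingDeficitKDatum (norm_covGrad_flux_eq_of_gaugeAct isUnitaryCfg_gaugeAct)
open BlockAverageCurrent (smallField_gaugeAct)
open MinimalActionSandwich (IsMinimiser)
open MinimalActionRate (Regular sfClass)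
open NE3EnergyShapes (IsUnitarySite IsPeriodicSite)
open NE3ResidualSliceRep (isPeriodicCfg_gaugeAct)
open NE7EtaSmoothGaugeTransport (isMinimiser_pair_gaugeAct)

noncomputable section

variable {d : ℕ} {n : Type*} [Fintype n] [DecidableEq n]

/-! ## §1 The flux-gradient budget is gauge invariant on small fields -/

/-- On a small field of radius `a < 1` every plaquette holonomy `fhol` is within `1` of the identity (the side condition of the K-datum
invariance lemma). [folklore] -/
theorem norm_fhol_sub_one_lt_one {U : Site d → Fin d → (Matrix n n ℂ)ˣ} {a : ℝ} (ha : a < 1) (hS : SmallField U a) (x : Site d)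
    (π : T4AveragingDeficitWall.Plane d) :
    ‖((fhol U (x, π) : (Matrix n n ℂ)ˣ) : Matrix n n ℂ) - 1‖ < 1 :=
  (hS x π.1.1 π.1.2 (ne_of_lt π.2)).trans_lt ha

/-- **THE FLUX-GRADIENT BUDGET IS GAUGE INVARIANT**: `gradFluxSq (U^u) S = gradFluxSq U S` for unitary `u` and `SmallField U a` with `a < 1`
(termwise `AveragingDeficitKDatum.norm_covGrad_flux_eq_of_gaugeAct`). [folklore] -/
theorem gradFluxSq_gaugeAct [Nonempty n] {u : Site d → (Matrix n n ℂ)ˣ} (hu : IsUnitarySite u) {U : Site d → Fin d → (Matrix n n ℂ)ˣ}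
    {a : ℝ} (ha : a < 1) (hS : SmallField U a) (S : Finset (Site d)) :
    gradFluxSq (gaugeAct u U) S = gradFluxSq U S := by
  have hS' : SmallField (gaugeAct u U) a := smallField_gaugeAct hu hS
  unfold gradFluxSq
  refine sum_congr rfl fun x _ => sum_congr rfl fun κ _ => sum_congr rfl fun π _ => ?_
  rw [norm_covGrad_flux_eq_of_gaugeAct hu U x κ π (norm_fhol_sub_one_lt_one ha hS' x π)
    (norm_fhol_sub_one_lt_one ha hS' (x + e κ) π)]

/-! ## §2 `Regular` is gauge invariant -/

/-- **THE CLASS DATA `Regular` OF A BACKGROUND IS GAUGE INVARIANT**: for `Regular d L N b g j U` with `b < 1`, `1 ≤ L`, and a unitary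
`N·L^j`-periodic site gauge `u`, `Regular d L N b g j (U^u)` (unitary by unitarity, periodic by periodicity, small field by conjugation,
flux-gradient budget by `gradFluxSq_gaugeAct` — the radius `b∕(L^j)² ≤ b < 1`). [folklore] -/
theorem regular_gaugeAct [Nonempty n] {L N j : ℕ} (hL : 1 ≤ L) {b g : ℝ} (hb1 : b < 1) {U : Site d → Fin d → (Matrix n n ℂ)ˣ}
    (h : Regular d L N b g j U) {u : Site d → (Matrix n n ℂ)ˣ} (hu : IsUnitarySite u) (huP : IsPeriodicSite u ((N * L ^ j : ℕ) : ℤ)) :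
    Regular d L N b g j (gaugeAct u U) := by
  have hL1 : (1 : ℝ) ≤ (L : ℝ) := by exact_mod_cast hL
  have hpow : (1 : ℝ) ≤ ((L : ℝ) ^ j) ^ 2 := one_le_pow₀ (one_le_pow₀ hL1)
  have hrad : b / ((L : ℝ) ^ j) ^ 2 < 1 := by
    rcases le_or_gt 0 b with hb0 | hb0
    · exact (div_le_self hb0 hpow).trans_lt hb1
    · exact (div_neg_of_neg_of_pos hb0 (by positivity)).trans one_pos
  refine ⟨isUnitaryCfg_gaugeAct hu h.unitary, isPeriodicCfg_gaugeAct huP h.periodic, smallField_gaugeAct hu h.small, ?_⟩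
  rw [gradFluxSq_gaugeAct hu hrad h.small]
  exact h.grad

/-! ## §3 The root's antecedents for the re-gauged pair -/

/-- **THE ROOT'S THREE ANTECEDENTS HOLD VERBATIM FOR THE SMOOTH-GAUGE SELECTION** (bill (G5) item (3)): if `U_A`, `U_B` minimise runs `j+1`,
`j+2` of the small-field class for the datum `V` and `U_B` is `Regular` (`b < 1`), then for every unitary `N·L^{j+2}`-periodic gauge `u_B` of
run B the re-gauged pair `(U_A^{u_B∘(L•)}, U_B^{u_B})` minimises runs `j+1`, `j+2` for the datum `ū·V`, `ū = u_B∘(L^{j+2}•)`, AND `U_B^{u_B}` is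
`Regular` with the same `(b, g)` — so NE3's root (quantified over all data of `dom` and all such triples) applies at `ū·V ∈ dom`. [folklore] -/
theorem covRoot_hypotheses_gaugeAct [Nonempty n] {L N : ℕ} (hL : 1 ≤ L) {ε : ℝ} (hε : 0 ≤ ε) (j : ℕ)
    (hsA : LevelSmall d L j (ε / ((L : ℝ) ^ (j + 1)) ^ 2)) (hsB : LevelSmall d L (j + 1) (ε / ((L : ℝ) ^ (j + 2)) ^ 2))
    {b g : ℝ} (hb1 : b < 1) {V UA UB : Site d → Fin d → (Matrix n n ℂ)ˣ}
    (hA : IsMinimiser d (sfClass d L N ε) L N (j + 1) V UA) (hB : IsMinimiser d (sfClass d L N ε) L N (j + 2) V UB)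
    (hreg : Regular d L N b g (j + 2) UB)
    {uB : Site d → (Matrix n n ℂ)ˣ} (hu : IsUnitarySite uB) (huP : IsPeriodicSite uB ((N * L ^ (j + 2) : ℕ) : ℤ)) :
    IsMinimiser d (sfClass d L N ε) L N (j + 1) (gaugeAct (fun w : Site d => uB (((L : ℤ) ^ (j + 2)) • w)) V)
        (gaugeAct (fun x : Site d => uB ((L : ℤ) • x)) UA) ∧
      IsMinimiser d (sfClass d L N ε) L N (j + 2) (gaugeAct (fun w : Site d => uB (((L : ℤ) ^ (j + 2)) • w)) V)
        (gaugeAct uB UB) ∧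
      Regular d L N b g (j + 2) (gaugeAct uB UB) := by
  obtain ⟨h1, h2⟩ := isMinimiser_pair_gaugeAct hL hε j hsA hsB hA hB hu huP
  exact ⟨h1, h2, regular_gaugeAct hL hb1 hreg hu huP⟩

end

end Summit.QuantumFields.BalabanUV.T4Continuum.NE7EtaRegularGaugeInvariance
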